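import Summits.RiemannHypothesis.RiemannHypothesis.Theorems.WeilFormatCDataO102BFrontData
import Summits.RiemannHypothesis.RiemannHypothesis.Theorems.S2FormatCE0
import Literature.NumberTheory.LFunctions.YoshidaWindowGramTailMSSines
import Literature.NumberTheory.LFunctions.YoshidaWindowGramMiddleJBox
import Literature.NumberTheory.LFunctions.YoshidaWindowGramTailJFactoredScaled
import Literature.NumberTheory.LFunctions.YoshidaWindowGramTailMSFactored
import Literature.NumberTheory.LFunctions.YoshidaWindowGramTailJDiagTight
import Summits.RiemannHypothesis.RiemannHypothesis.Theorems.FormatCPsdBands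
import Summits.RiemannHypothesis.RiemannHypothesis.Theorems.WeilFormatCDiagShift
import HarnessLib

/-!
# Format C kernel rung `O102B` (a = 51/50, column-band layout): front-door constants, far-diagonal endpoints, tail bases and the reciprocal column weights of both sectors (kernel certificates; blocks B = 32/256, B₃ = 64/512 (K = 32/256 certified columns))

Window `a = 51/50`; prime powers in the window: 2, 3, 2^2, 5, 7; prime constant A = 2148/1000 (`WeilFormatC.primeCoeff_form_ge_cells_v2`); evaluator parameters S = 2^320, Kpi 160, Kser 190, kred 8, Kexp 55, J 150; full table modes < 257; light column table modes < 1027; units 2^-310 (Schur entries), 2^-154 (column digits, width 157), 2^-148 (tail-factor digits, width 151), 2^-64 (reciprocal weights), 2^-40 (tail base); order-J tail J = 4, θ = 1/2048, η = 1/10 | 4/1.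
Design row: sr-gb-rung-a A g23 odd λ-run (parity cell 13 L-side): a = 51/50, μ = 2^-93, odd 256/512/1024, HIGHER precision S 2^320 c 310, MS tail, five prime powers; see HOME(A)/LADDER-CELL12-A-g23.md. Generated by sr-gb-rung-a prover A g22 with rh-explicit-weil-2 gen7's generator extended for the odd λ-run (--sector odd --mu-log2; HOME(A)/code-g22/gen7/gramgen7.py sha16 a23c13b0256hp001) from `#eval` of the tree's `Encl` functions; every datum is re-verified by the kernel in the theorem files (`decide +kernel`). Helper data of the rh-explicit Weil-positivity programme (format C, K-CELL-2), RH-free. [cite: Yoshida1992HermitianForms, §5 (5.15)-(5.16) p. 301; §7 pp. 305–312]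
-/

set_option linter.dupNamespace false
set_option exponentiation.threshold 1024
set_option maxRecDepth 200000

namespace Summit.RiemannHypothesis.RiemannHypothesis.Theorems.WeilFormatCData.O102B
open Literature.NumberTheory.LFunctions Literature.NumberTheory.LFunctions.Yoshida1992 Encl Literature.Analysis.ValidatedNumerics.NumericsMP

/-- kernel: the front-door constants (and floors) are valid. -/
theorem tF : checkFDConsts O102B.prm O102B.C 5 O102B.ns O102B.F = true := by decide +kernel

/-- kernel: `√(8/Bo) ≤ 185365/1048576`. -/
theorem tSqO : checkSqrtUpper 8 O102BCBOdd.B 185365 1048576 = true := by decide +kernel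

/-- kernel: `0 < core⁻_A(256) − π/4 − …` (box endpoint). -/
theorem t0O : 0 < (devOddBox (2 ^ 320) O102B.C O102B.FA (tget O102B.ctab (256 + 1)) 256 256 185365 1048576).lo := by decide +kernel

/-- kernel: the odd tail base `d₀ = 1346682168655·2^-40`. -/
theorem tDO : (1346682168655 : ℤ) * ((2 ^ 320 : ℕ) : ℤ) ≤ (devOddBox (2 ^ 320) O102B.C O102B.FA (tget O102B.ctab (1024 + 1)) 1024 256 185365 1048576).lo * 2 ^ 40 := by decide +kernel

/-- kernel: the Schur bands' weights are the prefix of the certified list (odd). -/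
theorem tVwO : O102BCBOdd.vw.take 256 = O102BCBOdd.v := by decide +kernel

/-- kernel: the sine lower-bound data are certified. -/
theorem tSines : checkSines O102B.prm O102B.C O102B.ks O102B.csd O102B.sd1 O102B.sdm O102B.sdp = true := by decide +kernel

/-- kernel: shape of the odd weight list. -/
theorem tVo : O102BCBOdd.v.length = 256 ∧ sumList O102BCBOdd.v = O102BCBOdd.V := by decide +kernel

end Summit.RiemannHypothesis.RiemannHypothesis.Theorems.WeilFormatCData.O102B
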